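import Summits.AnomalousDissipation.AnomalousDissipation.Theorems.MomentParityResolvedDissipationInvariance
import Literature.Analysis.FluidPDE.GalerkinFlow

/-!
# Stub `stub_zeroMean_galerkinFlow` for line `enstrophy-ui-transfer` (crux `MomentParity.ResolvedDissipation`, stmt-AnomalousDissipation-14284)

Sorry-free discharge of the registered stub `stub_zeroMean_galerkinFlow` (S2a) of the lead's
skeleton v3: the level-`N` Galerkin semiflow `Torus.galerkinFlow ν f N` of the forced
Navier–Stokes equations on `T³` with a mean-zero force `f` PRESERVES ZERO MEAN on Galerkin modes
(the input of the Poincaré step of the pathwise dissipation bound along Galerkin orbits).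

**Proof.** On a Galerkin mode `a` the coefficients of the slice at time `t` on the frequency ball
are the coefficient orbit `α t := galerkinCoeffFlow ν (f̂|_{≤N}) t (â|_{≤N})`
(`IsGalerkinMode.fourierRestrict_galerkinFlow`), and a real field whose Fourier coefficient at the
frequency `0` vanishes has zero mean (`û(0) = complexify (∫ u)`). The mean mode `s ↦ α s 0` has
right derivative `galerkinRHS (freqBall N) ν (f̂|_{≤N}) (α s) 0 = 0` on `[0, t)` (the orbit solves
the Galerkin ODE, `isGalerkinODESolution_galerkinCoeffFlow`; the Galerkin field of a mean-zero
force has no mean mode on the phase space, `MomentParity.galerkinRHS_apply_zero`: `|0|² = 0`,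
`leraySym 0 = id`, and the convection sum at `k = 0` pairs `l = -m` and dies by transversality),
hence is constant on `[0, t]` (`constant_of_has_deriv_right_zero`) and equals
`α 0 0 = â(0) = 0` because `∫ a = 0`.

References: Constantin–Foias, *Navier–Stokes Equations* (Chicago 1988), Ch. 8, (8.5)–(8.6);
Robinson–Rodrigo–Sadowski, *The three-dimensional Navier–Stokes equations* (CUP 2016), §4.1.
-/

noncomputable section

-- `Summit.<Summit>.<Problem>`: single-conjunct summit, the duplicate namespace segment is mandated.
set_option linter.dupNamespace false

namespace Summit.AnomalousDissipation.AnomalousDissipation.Theorems.MomentParityResolvedDissipation.ZeroMeanFlow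

open MeasureTheory Filter Topology Set
open scoped ENNReal InnerProductSpace RealInnerProductSpace
open Literature.Analysis.FunctionSpaces Literature.Analysis.FluidPDE
open Summit.AnomalousDissipation.AnomalousDissipation.Theses.MomentParity
open Summit.AnomalousDissipation.AnomalousDissipation.Theorems.CubicParityLoud.Negative (T3 R3 H3 L2T3)
open Summit.AnomalousDissipation.AnomalousDissipation.Theorems.QuarticGate.Negative
  (IsLevel IsBandTest polyGrad IsPolyStationary)

/-- **A real field without mean mode has zero mean**: `𝓕(complexify ∘ u)(0) = complexify (∫ u)`
(the character `e₀` is `1`), and `complexify` is injective, so `û(0) = 0` forces `∫ u = 0`.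
[folklore; Grafakos, *Classical Fourier Analysis*, §3.1] -/
private theorem hasZeroMean_of_mFourierCoeff_zero {d : Type*} [Fintype d]
    {u : UnitAddTorus d → EuclideanSpace ℝ d}
    (h0 : UnitAddTorus.mFourierCoeff (EuclideanSpace.complexify ∘ u) 0 = 0) :
    Torus.HasZeroMean u := by
  have h : UnitAddTorus.mFourierCoeff (EuclideanSpace.complexify ∘ u) 0 =
      EuclideanSpace.complexify (∫ x, u x) := by
    rw [Torus.mFourierCoeff_eq_integral_volume, neg_zero, UnitAddTorus.mFourier_zero]
    simp only [ContinuousMap.one_apply, one_smul, Function.comp_apply]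
    exact EuclideanSpace.complexify.integral_comp_comm u
  rw [h] at h0
  exact EuclideanSpace.complexify_injective (by rw [h0, map_zero])

/-- **The mean mode of a Galerkin coefficient orbit stays zero.** For `ν ≥ 0`, an integrable
mean-zero force `f` on `T³` and a datum `c₀` in the level-`N` phase space with `c₀ 0 = 0`, the
forward orbit `t ↦ galerkinCoeffFlow ν (f̂|_{≤N}) t c₀` has vanishing mean mode at every `t ≥ 0`:
its mean mode has right derivative `galerkinRHS … 0 = 0` (`MomentParity.galerkinRHS_apply_zero`)
and is continuous on `[0, t]`, hence constant (`constant_of_has_deriv_right_zero`).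
[folklore; Constantin–Foias 1988, Ch. 8, (8.5)–(8.6)] -/
theorem galerkinCoeffFlow_apply_zero_eq_zero {ν : ℝ} (hν : 0 ≤ ν) {f : T3 → R3}
    (hfi : Integrable f volume) (hfz : Torus.HasZeroMean f) {N : ℕ}
    {c₀ : ↥(Torus.freqBall (d := Fin 3) N) → EuclideanSpace ℂ (Fin 3)}
    (hc₀ : c₀ ∈ galerkinSubspace (Torus.freqBall N))
    (hc₀0 : c₀ ⟨0, Torus.zero_mem_freqBall N⟩ = 0) {t : ℝ} (ht : 0 ≤ t) :
    galerkinCoeffFlow ν (fourierRestrict (Torus.freqBall N) f) t c₀ ⟨0, Torus.zero_mem_freqBall N⟩ = 0 := by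
  -- the forward orbit solves the Galerkin ODE with the (real) force coefficients `f̂|_{≤N}`
  have hsol : IsGalerkinODESolution ν (fourierRestrict (Torus.freqBall N) f) c₀
      fun s => galerkinCoeffFlow ν (fourierRestrict (Torus.freqBall N) f) s c₀ :=
    isGalerkinODESolution_galerkinCoeffFlow hν Torus.neg_mem_freqBall_of_mem
      (Torus.isRealCoeff_mFourierCoeff hfi) hc₀
  -- its mean mode has vanishing right derivative on `[0, t)` ...
  have hderiv : ∀ s ∈ Ico 0 t, HasDerivWithinAt
      (fun s => galerkinCoeffFlow ν (fourierRestrict (Torus.freqBall N) f) s c₀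
        ⟨0, Torus.zero_mem_freqBall N⟩) 0 (Ici s) s := by
    intro s hs
    have h : HasDerivWithinAt
        (fun s => galerkinCoeffFlow ν (fourierRestrict (Torus.freqBall N) f) s c₀
          ⟨0, Torus.zero_mem_freqBall N⟩)
        (galerkinRHS (Torus.freqBall N) ν (fourierRestrict (Torus.freqBall N) f)
          (galerkinCoeffFlow ν (fourierRestrict (Torus.freqBall N) f) s c₀)
          ⟨0, Torus.zero_mem_freqBall N⟩) (Ici s) s :=
      hasDerivWithinAt_pi.1 (hsol.hasDerivWithinAt_Ici hs) _
    exact h.congr_deriv (MomentParity.galerkinRHS_apply_zero ν hfi hfz (galerkinCoeffFlow_mem hc₀ s))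
  -- ... and is continuous on `[0, t]`, hence constant there, equal to its value `c₀ 0 = 0` at `0`
  have hcont : ContinuousOn
      (fun s => galerkinCoeffFlow ν (fourierRestrict (Torus.freqBall N) f) s c₀
        ⟨0, Torus.zero_mem_freqBall N⟩) (Icc 0 t) :=
    ((continuous_apply _).comp_continuousOn hsol.continuousOn).mono Icc_subset_Ici_self
  rw [constant_of_has_deriv_right_zero hcont hderiv t (right_mem_Icc.2 ht), galerkinCoeffFlow_zero]
  exact hc₀0

/-- **S2a — THE GALERKIN SEMIFLOW PRESERVES ZERO MEAN.** For `ν ≥ 0`, a smooth mean-zero force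
`f` and a mean-zero Galerkin mode `a` of order `N`, every forward slice
`Torus.galerkinFlow ν f N t a` (`t ≥ 0`) of the level-`N` Galerkin orbit has zero mean: its
zeroth Fourier coefficient is the mean mode of the coefficient orbit of `â|_{≤N}`
(`IsGalerkinMode.fourierRestrict_galerkinFlow`), which keeps its initial value `â(0) = 0`
(`galerkinCoeffFlow_apply_zero_eq_zero`). [folklore; Constantin–Foias 1988, Ch. 8;
Robinson–Rodrigo–Sadowski 2016, §4.1] -/
theorem stub_zeroMean_galerkinFlow :
    ∀ (ν : ℝ), 0 ≤ ν → ∀ (f : T3 → R3), Torus.IsSmooth f → Torus.HasZeroMean f →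
    ∀ (N : ℕ) (a : T3 → R3), IsGalerkinMode N a → Torus.HasZeroMean a →
    ∀ t : ℝ, 0 ≤ t → Torus.HasZeroMean (Torus.galerkinFlow ν f N t a) := by
  intro ν hν f hf hfz N a ha ha0 t ht
  refine hasZeroMean_of_mFourierCoeff_zero ?_
  -- the zeroth coefficient of the slice is the mean mode of the coefficient orbit
  have h := congrFun (ha.fourierRestrict_galerkinFlow (ν := ν) (f := f) t)
    ⟨0, Torus.zero_mem_freqBall N⟩
  rw [fourierRestrict_apply] at h
  rw [h]
  -- the datum `â|_{≤N}` lies in the phase space and has no mean mode (`∫ a = 0`)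
  refine galerkinCoeffFlow_apply_zero_eq_zero hν hf.integrable hfz ha.fourierRestrict_mem ?_ ht
  rw [fourierRestrict_apply]
  exact Torus.mFourierCoeff_complexify_zero_of_hasZeroMean ha.isSmooth.integrable ha0

end Summit.AnomalousDissipation.AnomalousDissipation.Theorems.MomentParityResolvedDissipation.ZeroMeanFlow

end
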